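import Summits.ABC.IUTFork.LDHGenuinePerImageShellUniformPoleL
import Summits.ABC.IUTFork.LDHGenuinePerImageSharpWildPoleLShellRat
import HarnessLib

/-!
# The fork at [IUTchIII] Corollary 3.12, L-DH level, READING (P): the UNIFORM POLE-`l` SHELL THEOREM, part 4 — the SHELL TEST UNIFORMLY IN
# THE PRIME `l ≥ L₀`, ALL POLES OF EVEN ORDER INCLUDED (abc-iut cell, crux ThetaPartII = stmt-ABC-19678; R-H round-4 census row O-18
# residual R-P, family «C:PERIMAGE-LEVEL»; parts 1–3 = `LDHGenuinePerImageLevelPoleL`, `…UniformPoleL`, `…ShellUniformPoleL`)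

Record-only PROOF file (D-0012) of the abc-iut cell (seat abc-iut-L5-t8, gen 14). TAKES NO SIDE on [IUTchIII] Cor. 3.12.
`q ∈ ℚ ∖ {0, 1}`, `j(q) = N/∏_{p∈I} p^{e_p}` in lowest terms. Part 3's `cor312PerImageOf_ratPoint_shell_uniform_poleL` turns abc-iut-c312-d1's
uniform shell inequality at `L₀` (p494091) into `T.Cor312PerImageOf` at every prime `l ≥ L₀` with the pole clause `e_l ≥ 6`; the poles of
order `e_l ∈ {2, 4}` were left out because no landed test carried both the shell term and the pole-`l` wild weight `2 − 1/(l−1)` of ★ p539739.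
`LDHGenuinePerImageSharpWildPoleLShellRat` (`Cor22.cor312PerImageOf_ratPoint_sharp_wild_poleL_shell`) is that test; THIS FILE closes the gap:

* **(T7) `Cor22.cor312PerImageOf_ratPoint_shell_uniform_allPoles`** — p494091's hypotheses VERBATIM (ONE inequality at `L₀ ≥ 7`, shell poles
  `Psh ⊆ I ∖ {2}`, `p ≤ L₀`, `p^{a_p} ≤ a_p·L₀·k_p`) give `T.Cor312PerImageOf` at every genuine Θ-volume datum `T` of `(q, l)` for EVERY prime
  `l ≥ L₀` such that, IF `l` is a pole, `2 ∣ e_l` or `e_l ≥ 6`, and `l ∉ Psh` (automatic for `l > L₀`). Cases BY NAME: `l ∉ I` — p494091;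
  pole with `e_l ≥ 6` — part 3 (the `q`-side drop); pole with `e_l ∈ {2,4}` — the floors+shell one-`l` test at `l`, whose bracket dominates the
  monotone image of the `L₀`-bracket: `χ_p − 1/m_p ≥ 1 − 1/(l·k_p)`, `log 2 ≥ ½·log 2`, `(2 − 1/(l−1))·log l = (1 − 1/(l−1))·log l + log l`
  absorbs the pole's own weight `(1 − 1/(l·k_l))·log l ≤ log l`, the shell terms increase with `l`. `…AtDatum…` twin and `…_of_forall_even`
  (all pole orders even ⇒ EVERY prime `l ≥ L₀` off the shell poles).

For the Frey–Legendre data of the cell's tables every pole order `e_p = 2·v_p(abc)` is even, so (T7) reads: ONE inequality per triple at a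
level `L₀` ⇒ the typed per-image Corollary at EVERY prime `l ≥ L₀` other than the chosen shell poles. HONEST SCOPE: statements about OUR
typed reading (P) (`Cor22.ThetaVolumeDatumAt.Cor312PerImageOf`, container (Ind2) = the tree's FULL lattice-automorphism indeterminacy) at
rational data. Nothing asserts that genuine Θ-data exist at these `(q, l)`, Cor. 3.12 in general or in print's reading, or abc;
proved-as-typed ≠ in print; located ≠ adjudicated. [cite: Mochizuki2012, IUTchI Def. 3.1 (a)(b)(c) p. 61–62; IUTchIII Cor. 3.12 p. 173–174,
proof Step (x) p. 181; IUTchIV Prop. 1.2 (i)(ii) p. 10, Thm. 1.10 p. 22–23, Step (ii) p. 24, Step (v) p. 27–29] [cite: DupuyHilado2025, §4.9,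
§4.12] [claim: Mochizuki2012, status: disputed] for every IUT quotation. PROOF-ONLY: no definitions, no new `Prop`, no instance, no notation.
-/

noncomputable section

open NumberField IsDedekindDomain Ideal Module

namespace Literature.IUT.LogVolume.Cor22

open Literature.NumberTheory.DiophantineGeometry.GenEll Summit.ABC.IUTFork Literature.IUT.HodgeTheaters
open Literature.NumberTheory.DiophantineGeometry.UniformABCConjecture

variable {q : ℚ} {N D : ℕ} {I : Finset ℕ} {e : ℕ → ℕ}

/-- `(1 − 1/(x−1))·log x` is monotone on `7 ≤ x` (p494091's private `lterm_mono`, re-derived). [folklore] -/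
private theorem lterm_mono_ap {L l : ℕ} (hL : 7 ≤ L) (hLl : L ≤ l) :
    (1 - ((L - 1 : ℕ) : ℝ)⁻¹) * Real.log L ≤ (1 - ((l - 1 : ℕ) : ℝ)⁻¹) * Real.log l := by
  have hL1 : (6 : ℝ) ≤ ((L - 1 : ℕ) : ℝ) := by
    have : 6 ≤ L - 1 := by omega
    exact_mod_cast this
  have hl1 : ((L - 1 : ℕ) : ℝ) ≤ ((l - 1 : ℕ) : ℝ) := by
    have : L - 1 ≤ l - 1 := by omega
    exact_mod_cast this
  have hLR : (7 : ℝ) ≤ L := by exact_mod_cast hL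
  have hlR : (L : ℝ) ≤ l := by exact_mod_cast hLl
  have hinv : ((l - 1 : ℕ) : ℝ)⁻¹ ≤ ((L - 1 : ℕ) : ℝ)⁻¹ := inv_anti₀ (by linarith) hl1
  have hinvL : ((L - 1 : ℕ) : ℝ)⁻¹ ≤ 6⁻¹ := inv_anti₀ (by norm_num) hL1
  have hlogL : 0 ≤ Real.log L := Real.log_nonneg (by linarith)
  have hlog : Real.log L ≤ Real.log l := Real.log_le_log (by linarith) hlR
  have h1 : 0 ≤ 1 - ((l - 1 : ℕ) : ℝ)⁻¹ := by linarith
  calc (1 - ((L - 1 : ℕ) : ℝ)⁻¹) * Real.log L ≤ (1 - ((l - 1 : ℕ) : ℝ)⁻¹) * Real.log L :=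
        mul_le_mul_of_nonneg_right (by linarith) hlogL
    _ ≤ (1 - ((l - 1 : ℕ) : ℝ)⁻¹) * Real.log l := mul_le_mul_of_nonneg_left hlog h1

/-- **(T7) RATIONAL POINTS, THE SHELL TEST UNIFORMLY IN THE PRIME `l ≥ L₀`, ALL POLES OF EVEN ORDER (AND ALL POLES OF ORDER `≥ 6`) INCLUDED**
(statement in words in the module docstring): p494091's ONE inequality at `L₀ ≥ 7` gives [IUTchIII] Cor. 3.12 in the cell's READING (P), AS TYPED,
at every genuine Θ-volume datum of `(q, l)` for EVERY prime `l ≥ L₀` such that, if `l` is a pole, `2 ∣ e_l ∨ e_l ≥ 6` and `l ∉ Psh`.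
[cite: Mochizuki2012, IUTchIII Cor. 3.12 p. 173–174, proof Step (x) p. 181] [cite: Mochizuki2012, IUTchIV Prop. 1.2 (i)(ii) p. 10, Thm. 1.10
Step (ii) p. 24, Step (v) p. 27–29] [claim: Mochizuki2012, status: disputed] -/
theorem cor312PerImageOf_ratPoint_shell_uniform_allPoles (hq0 : q ≠ 0) (hq1 : q ≠ 1)
    (hI : ∀ p ∈ I, p.Prime) (he : ∀ p ∈ I, e p ≠ 0) (hD : D = ∏ p ∈ I, p ^ e p)
    (hj : jInv q = (N : ℚ) / (D : ℚ)) (hN : N ≠ 0) (hcop : ∀ p ∈ I, ¬ p ∣ N)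
    (L₀ : ℕ) (hL7 : 7 ≤ L₀)
    (Psh : Finset ℕ) (a : ℕ → ℕ) (hPshI : Psh ⊆ I) (hPsh2 : ∀ p ∈ Psh, p ≠ 2) (hPshL : ∀ p ∈ Psh, p ≤ L₀)
    (hapos : ∀ p ∈ Psh, (p : ℝ) ^ (a p) ≤
      (a p : ℝ) * ((L₀ * Nat.lcm (30 / Nat.gcd 30 (e p)) (if p = 3 then 2 else if p = 5 then 4 else 1) : ℕ) : ℝ))
    (h : (1 / 6 : ℝ) * (∑ p ∈ I.filter (fun p => p ≠ 2), (e p : ℝ) * Real.log p) ≤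
      (∑ p ∈ I.filter (fun p => p ≠ 2),
          (1 - ((L₀ * Nat.lcm (30 / Nat.gcd 30 (e p)) (if p = 3 then 2 else if p = 5 then 4 else 1) : ℕ) : ℝ)⁻¹) * Real.log p)
        + 2⁻¹ * Real.log 2
        + (if 3 ∈ I then 0 else 2⁻¹ * Real.log 3)
        + (if 5 ∈ I then 0 else (3 / 4 : ℝ) * Real.log 5)
        + (1 - ((L₀ - 1 : ℕ) : ℝ)⁻¹) * Real.log L₀
        + (∑ p ∈ Psh, (((a p : ℕ) : ℝ) - (p : ℝ) ^ (a p) /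
            ((L₀ * Nat.lcm (30 / Nat.gcd 30 (e p)) (if p = 3 then 2 else if p = 5 then 4 else 1) : ℕ) : ℝ)) * Real.log p)
        + Real.log Real.pi)
    {l : ℕ} (hl : l.Prime) (hLl : L₀ ≤ l) (hpole : l ∈ I → (2 ∣ e l ∨ 6 ≤ e l) ∧ l ∉ Psh)
    (T : ThetaVolumeDatumAt (ratPoint q) l) : T.Cor312PerImageOf := by
  classical
  by_cases hlI : l ∈ I
  swap
  · -- NOT a pole: p494091 verbatim
    exact cor312PerImageOf_ratPoint_shell_uniform hq0 hq1 hI he hD hj hN hcop L₀ hL7 Psh a hPshI hPsh2 hPshL hapos h hl hLl hlI T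
  obtain ⟨hor, hlP⟩ := hpole hlI
  rcases (show 6 ≤ e l ∨ e l < 6 by omega) with h6 | hlt6
  · -- pole of order `≥ 6`: part 3
    exact cor312PerImageOf_ratPoint_shell_uniform_poleL hq0 hq1 hI he hD hj hN hcop L₀ hL7 Psh a hPshI hPsh2 hPshL hapos h hl hLl
      (fun _ => ⟨h6, hlP⟩) T
  -- pole of order `e_l ∈ {2, 4}`: even, `l ∤ e_l/2` — the floors+shell one-`l` test at `l`
  have hev : 2 ∣ e l := by
    rcases hor with h2 | h6
    · exact h2
    · omega
  have hndvd : ¬ l ∣ e l / 2 := by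
    intro hd
    have hpos : 0 < e l / 2 := Nat.div_pos (Nat.le_of_dvd (Nat.pos_of_ne_zero (he l hlI)) hev) two_pos
    have := Nat.le_of_dvd hpos hd
    omega
  have h7 : 7 ≤ l := le_trans hL7 hLl
  have hl2 : l ≠ 2 := by omega
  have hlR : (7 : ℝ) ≤ l := by exact_mod_cast h7
  have hlpos : (0 : ℝ) < l := by linarith
  set k : ℕ → ℕ := fun p => Nat.lcm (30 / Nat.gcd 30 (e p)) (if p = 3 then 2 else if p = 5 then 4 else 1) with hk
  have hkpos : ∀ p, 0 < k p := by
    intro p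
    refine Nat.pos_of_ne_zero (Nat.lcm_ne_zero ?_ (by split_ifs <;> norm_num))
    exact (Nat.div_pos (Nat.le_of_dvd (by norm_num) (Nat.gcd_dvd_left 30 (e p))) (Nat.gcd_pos_of_pos_left _ (by norm_num))).ne'
  have hlogp : ∀ p ∈ I, 0 ≤ Real.log (p : ℝ) := fun p hp =>
    Real.log_nonneg (by exact_mod_cast (hI p hp).one_lt.le)
  -- the shell poles are admissible at `l`
  have hPsh : ∀ p ∈ Psh, p ≠ 2 ∧ p ≠ l ∧ ¬ l ∣ p - 1 := by
    intro p hpP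
    have hpp := hI p (hPshI hpP)
    have hpL := hPshL p hpP
    have hpl : p ≠ l := fun h' => hlP (h' ▸ hpP)
    refine ⟨hPsh2 p hpP, hpl, fun hdvd => ?_⟩
    have hp3 : 3 ≤ p := by
      rcases hpp.eq_two_or_odd with h2 | hodd
      · exact absurd h2 (hPsh2 p hpP)
      · have := hpp.two_le; omega
    have := Nat.le_of_dvd (by omega) hdvd
    omega
  refine cor312PerImageOf_ratPoint_sharp_wild_poleL_shell hq0 hq1 hl h7 hI he hD hj hN hcop hlI hev hndvd Psh a hPshI hPsh ?_ T
  rw [logQAvoid_ratPoint_two_prime_eq_sum_ne hI he hD hj hN hcop hl]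
  -- split the two full sums at the pole `l`
  have hl2I : l ∈ I.filter (fun p => p ≠ 2) := Finset.mem_filter.mpr ⟨hlI, hl2⟩
  have hfilt : I.filter (fun p => p ≠ 2 ∧ p ≠ l) = (I.filter (fun p => p ≠ 2)).erase l := by
    ext p
    simp only [Finset.mem_filter, Finset.mem_erase]
    tauto
  have hQsplit : (∑ p ∈ I.filter (fun p => p ≠ 2), (e p : ℝ) * Real.log p) =
      (∑ p ∈ I.filter (fun p => p ≠ 2 ∧ p ≠ l), (e p : ℝ) * Real.log p) + (e l : ℝ) * Real.log l := by
    rw [hfilt]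
    exact (Finset.sum_erase_add _ _ hl2I).symm
  have hWsplit : (∑ p ∈ I.filter (fun p => p ≠ 2), (1 - ((l * k p : ℕ) : ℝ)⁻¹) * Real.log p) =
      (∑ p ∈ I.filter (fun p => p ≠ 2 ∧ p ≠ l), (1 - ((l * k p : ℕ) : ℝ)⁻¹) * Real.log p)
        + (1 - ((l * k l : ℕ) : ℝ)⁻¹) * Real.log l := by
    rw [hfilt]
    exact (Finset.sum_erase_add _ _ hl2I).symm
  -- (1) weights: monotone `L₀ → l`, the pole's own weight `≤ log l`, and `χ_p − 1/m_p ≥ 1 − 1/m_p`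
  have hW : ∀ p ∈ I.filter (fun p => p ≠ 2),
      (1 - ((L₀ * k p : ℕ) : ℝ)⁻¹) * Real.log p ≤ (1 - ((l * k p : ℕ) : ℝ)⁻¹) * Real.log p := by
    intro p hp
    have hkp : (0 : ℝ) < k p := by exact_mod_cast hkpos p
    have h1 : ((L₀ * k p : ℕ) : ℝ) ≤ ((l * k p : ℕ) : ℝ) := by exact_mod_cast Nat.mul_le_mul_right _ hLl
    have h0 : (0 : ℝ) < ((L₀ * k p : ℕ) : ℝ) := by push_cast; positivity
    have hinv := inv_anti₀ h0 h1
    exact mul_le_mul_of_nonneg_right (by linarith) (hlogp p (Finset.mem_filter.mp hp).1)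
  have hWsum := Finset.sum_le_sum hW
  have hlogl : 0 ≤ Real.log l := Real.log_nonneg (by linarith)
  have hWl : (1 - ((l * k l : ℕ) : ℝ)⁻¹) * Real.log l ≤ Real.log l := by
    have h0 : (0 : ℝ) ≤ ((l * k l : ℕ) : ℝ)⁻¹ := by positivity
    nlinarith
  have hWχ : (∑ p ∈ I.filter (fun p => p ≠ 2 ∧ p ≠ l), (1 - ((l * k p : ℕ) : ℝ)⁻¹) * Real.log p) ≤
      ∑ p ∈ I.filter (fun p => p ≠ 2 ∧ p ≠ l),
        ((if (p = 3 ∨ p = 5) ∧ 2 ∣ e p ∧ ¬ p ∣ e p / 2 then (2 : ℝ) else 1) - ((l * k p : ℕ) : ℝ)⁻¹) * Real.log p := by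
    refine Finset.sum_le_sum fun p hp => ?_
    have hχ : (1 : ℝ) ≤ (if (p = 3 ∨ p = 5) ∧ 2 ∣ e p ∧ ¬ p ∣ e p / 2 then (2 : ℝ) else 1) := by
      split_ifs <;> norm_num
    exact mul_le_mul_of_nonneg_right (by linarith) (hlogp p (Finset.mem_filter.mp hp).1)
  -- (2) shell terms: monotone, nonnegative at `L₀`
  have hS : ∀ p ∈ Psh,
      (((a p : ℕ) : ℝ) - (p : ℝ) ^ (a p) / ((L₀ * k p : ℕ) : ℝ)) * Real.log p ≤
        (((a p : ℕ) : ℝ) - (p : ℝ) ^ (a p) / ((l * k p : ℕ) : ℝ)) * Real.log p := by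
    intro p hp
    have hkp : (0 : ℝ) < k p := by exact_mod_cast hkpos p
    have h1 : ((L₀ * k p : ℕ) : ℝ) ≤ ((l * k p : ℕ) : ℝ) := by exact_mod_cast Nat.mul_le_mul_right _ hLl
    have h0 : (0 : ℝ) < ((L₀ * k p : ℕ) : ℝ) := by push_cast; positivity
    have hdiv := div_le_div_of_nonneg_left (by positivity : (0 : ℝ) ≤ (p : ℝ) ^ (a p)) h0 h1
    exact mul_le_mul_of_nonneg_right (by linarith) (hlogp p (hPshI hp))
  have hSsum := Finset.sum_le_sum hS
  have hS0 : 0 ≤ ∑ p ∈ Psh, (((a p : ℕ) : ℝ) - (p : ℝ) ^ (a p) / ((L₀ * k p : ℕ) : ℝ)) * Real.log p := by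
    refine Finset.sum_nonneg fun p hp => ?_
    have hkp : (0 : ℝ) < k p := by exact_mod_cast hkpos p
    have h0 : (0 : ℝ) < ((L₀ * k p : ℕ) : ℝ) := by push_cast; positivity
    have hle : (p : ℝ) ^ (a p) / ((L₀ * k p : ℕ) : ℝ) ≤ (a p : ℝ) := by
      rw [div_le_iff₀ h0]
      exact hapos p hp
    exact mul_nonneg (by push_cast at hle ⊢; linarith) (hlogp p (hPshI hp))
  have hShl : 0 ≤ ∑ p ∈ Psh, (((a p : ℕ) : ℝ) - (p : ℝ) ^ (a p) / ((l * k p : ℕ) : ℝ)) * Real.log p :=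
    hS0.trans hSsum
  -- (3) the `l`-term and the constants
  have hLt := lterm_mono_ap hL7 hLl
  have hpi : 0 < Real.log Real.pi := Real.log_pos (by linarith [Real.pi_gt_three])
  have hlog2 : 0 < Real.log 2 := Real.log_pos (by norm_num)
  have hX0 : 0 ≤ ∑ p ∈ I.filter (fun p => p ≠ 2 ∧ p ≠ l), (e p : ℝ) * Real.log p :=
    Finset.sum_nonneg fun p hp => mul_nonneg (Nat.cast_nonneg _) (hlogp p (Finset.mem_filter.mp hp).1)
  have hel0 : 0 ≤ (e l : ℝ) * Real.log l := mul_nonneg (Nat.cast_nonneg _) hlogl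
  -- (4) the unscaled inequality at `l`: `Q₀/6 ≤ Wχ_l + log 2 + c3 + c5 + (2 − 1/(l−1))·log l + Sh_l + log π`
  have hkey : (1 / 6 : ℝ) * (∑ p ∈ I.filter (fun p => p ≠ 2 ∧ p ≠ l), (e p : ℝ) * Real.log p) ≤
      (∑ p ∈ I.filter (fun p => p ≠ 2 ∧ p ≠ l),
          ((if (p = 3 ∨ p = 5) ∧ 2 ∣ e p ∧ ¬ p ∣ e p / 2 then (2 : ℝ) else 1) - ((l * k p : ℕ) : ℝ)⁻¹) * Real.log p)
        + Real.log 2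
        + (if 3 ∈ I then 0 else 2⁻¹ * Real.log 3)
        + (if 5 ∈ I then 0 else (3 / 4 : ℝ) * Real.log 5)
        + (2 - ((l - 1 : ℕ) : ℝ)⁻¹) * Real.log l
        + (∑ p ∈ Psh, (((a p : ℕ) : ℝ) - (p : ℝ) ^ (a p) / ((l * k p : ℕ) : ℝ)) * Real.log p)
        + Real.log Real.pi := by
    rw [hQsplit] at h
    rw [hWsplit] at hWsum
    nlinarith [h, hWsum, hWl, hWχ, hSsum, hLt, hlogl, hlog2, hel0]
  -- (5) scale by `(l+1)/4 = (l+5)/4 − 1`; `κ_l ≤ (l+1)/24`; `(l+5)/4 ≥ (l+1)/4` on the nonnegative shell and `log π`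
  have hl1 : (0 : ℝ) ≤ ((l : ℝ) + 1) / 4 := by positivity
  have h1 : (((l : ℝ) + 1) / 24 - 1 / (2 * l)) * (∑ p ∈ I.filter (fun p => p ≠ 2 ∧ p ≠ l), (e p : ℝ) * Real.log p) ≤
      ((l : ℝ) + 1) / 24 * (∑ p ∈ I.filter (fun p => p ≠ 2 ∧ p ≠ l), (e p : ℝ) * Real.log p) := by
    have h0 : 0 ≤ 1 / (2 * (l : ℝ)) * (∑ p ∈ I.filter (fun p => p ≠ 2 ∧ p ≠ l), (e p : ℝ) * Real.log p) := by
      positivity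
    rw [sub_mul]
    linarith
  have h2 := mul_le_mul_of_nonneg_left hkey hl1
  linarith [h1, h2, hShl, hpi]

/-- **(T7, all pole orders even)**: if every pole order `e_p` is even (the Frey–Legendre data), p494091's ONE inequality at `L₀ ≥ 7` gives the
typed per-image Corollary at EVERY prime `l ≥ L₀` off the shell poles, for every genuine Θ-volume datum. [cite: Mochizuki2012, IUTchIII
Cor. 3.12 p. 173–174; IUTchIV Thm. 1.10 Step (v) p. 27–29] [claim: Mochizuki2012, status: disputed] -/
theorem cor312PerImageOf_ratPoint_shell_uniform_allPoles_of_forall_even (hq0 : q ≠ 0) (hq1 : q ≠ 1)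
    (hI : ∀ p ∈ I, p.Prime) (he : ∀ p ∈ I, e p ≠ 0) (hD : D = ∏ p ∈ I, p ^ e p)
    (hj : jInv q = (N : ℚ) / (D : ℚ)) (hN : N ≠ 0) (hcop : ∀ p ∈ I, ¬ p ∣ N)
    (heven : ∀ p ∈ I, 2 ∣ e p)
    (L₀ : ℕ) (hL7 : 7 ≤ L₀)
    (Psh : Finset ℕ) (a : ℕ → ℕ) (hPshI : Psh ⊆ I) (hPsh2 : ∀ p ∈ Psh, p ≠ 2) (hPshL : ∀ p ∈ Psh, p ≤ L₀)
    (hapos : ∀ p ∈ Psh, (p : ℝ) ^ (a p) ≤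
      (a p : ℝ) * ((L₀ * Nat.lcm (30 / Nat.gcd 30 (e p)) (if p = 3 then 2 else if p = 5 then 4 else 1) : ℕ) : ℝ))
    (h : (1 / 6 : ℝ) * (∑ p ∈ I.filter (fun p => p ≠ 2), (e p : ℝ) * Real.log p) ≤
      (∑ p ∈ I.filter (fun p => p ≠ 2),
          (1 - ((L₀ * Nat.lcm (30 / Nat.gcd 30 (e p)) (if p = 3 then 2 else if p = 5 then 4 else 1) : ℕ) : ℝ)⁻¹) * Real.log p)
        + 2⁻¹ * Real.log 2
        + (if 3 ∈ I then 0 else 2⁻¹ * Real.log 3)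
        + (if 5 ∈ I then 0 else (3 / 4 : ℝ) * Real.log 5)
        + (1 - ((L₀ - 1 : ℕ) : ℝ)⁻¹) * Real.log L₀
        + (∑ p ∈ Psh, (((a p : ℕ) : ℝ) - (p : ℝ) ^ (a p) /
            ((L₀ * Nat.lcm (30 / Nat.gcd 30 (e p)) (if p = 3 then 2 else if p = 5 then 4 else 1) : ℕ) : ℝ)) * Real.log p)
        + Real.log Real.pi)
    {l : ℕ} (hl : l.Prime) (hLl : L₀ ≤ l) (hlP : l ∉ Psh) (T : ThetaVolumeDatumAt (ratPoint q) l) : T.Cor312PerImageOf :=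
  cor312PerImageOf_ratPoint_shell_uniform_allPoles hq0 hq1 hI he hD hj hN hcop L₀ hL7 Psh a hPshI hPsh2 hPshL hapos h hl hLl
    (fun hlI => ⟨Or.inl (heven l hlI), hlP⟩) T

/-- **(T7) in both readings at the Θ-data of `(q, l)`**: `Cor312PerImageAtDatum ∧ Cor312AtDatum` at every prime `l ≥ L₀` under p494091's
inequality with the pole clause `(2 ∣ e_l ∨ e_l ≥ 6) ∧ l ∉ Psh`. [cite: Mochizuki2012, IUTchIII Cor. 3.12 p. 173–174] [claim: Mochizuki2012, status: disputed] -/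
theorem cor312PerImageAtDatum_ratPoint_shell_uniform_allPoles (hq0 : q ≠ 0) (hq1 : q ≠ 1)
    (hI : ∀ p ∈ I, p.Prime) (he : ∀ p ∈ I, e p ≠ 0) (hD : D = ∏ p ∈ I, p ^ e p)
    (hj : jInv q = (N : ℚ) / (D : ℚ)) (hN : N ≠ 0) (hcop : ∀ p ∈ I, ¬ p ∣ N)
    (L₀ : ℕ) (hL7 : 7 ≤ L₀)
    (Psh : Finset ℕ) (a : ℕ → ℕ) (hPshI : Psh ⊆ I) (hPsh2 : ∀ p ∈ Psh, p ≠ 2) (hPshL : ∀ p ∈ Psh, p ≤ L₀)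
    (hapos : ∀ p ∈ Psh, (p : ℝ) ^ (a p) ≤
      (a p : ℝ) * ((L₀ * Nat.lcm (30 / Nat.gcd 30 (e p)) (if p = 3 then 2 else if p = 5 then 4 else 1) : ℕ) : ℝ))
    (h : (1 / 6 : ℝ) * (∑ p ∈ I.filter (fun p => p ≠ 2), (e p : ℝ) * Real.log p) ≤
      (∑ p ∈ I.filter (fun p => p ≠ 2),
          (1 - ((L₀ * Nat.lcm (30 / Nat.gcd 30 (e p)) (if p = 3 then 2 else if p = 5 then 4 else 1) : ℕ) : ℝ)⁻¹) * Real.log p)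
        + 2⁻¹ * Real.log 2
        + (if 3 ∈ I then 0 else 2⁻¹ * Real.log 3)
        + (if 5 ∈ I then 0 else (3 / 4 : ℝ) * Real.log 5)
        + (1 - ((L₀ - 1 : ℕ) : ℝ)⁻¹) * Real.log L₀
        + (∑ p ∈ Psh, (((a p : ℕ) : ℝ) - (p : ℝ) ^ (a p) /
            ((L₀ * Nat.lcm (30 / Nat.gcd 30 (e p)) (if p = 3 then 2 else if p = 5 then 4 else 1) : ℕ) : ℝ)) * Real.log p)
        + Real.log Real.pi)
    {l : ℕ} (hl : l.Prime) (hLl : L₀ ≤ l) (hpole : l ∈ I → (2 ∣ e l ∨ 6 ≤ e l) ∧ l ∉ Psh) :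
    Cor312PerImageAtDatum (ratPoint q) l ∧ Cor312AtDatum (ratPoint q) l :=
  have h' : Cor312PerImageAtDatum (ratPoint q) l := fun T =>
    cor312PerImageOf_ratPoint_shell_uniform_allPoles hq0 hq1 hI he hD hj hN hcop L₀ hL7 Psh a hPshI hPsh2 hPshL hapos h hl hLl hpole T
  ⟨h', cor312AtDatum_of_perImage h'⟩

end Literature.IUT.LogVolume.Cor22

end
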